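import Literature.MathematicalPhysics.QuantumFieldTheory.Balaban1983to89.B1TorusSubBoxChart
import Literature.MathematicalPhysics.QuantumFieldTheory.Balaban1983to89.B1TorusCubeBoxOp
import Literature.MathematicalPhysics.QuantumFieldTheory.Balaban1983to89.B4Lemma22NoCollarContours
import Literature.MathematicalPhysics.QuantumFieldTheory.Balaban1983to89.B1Cor23RegularRegion

/-!
# `Balaban1983to89.B1TorusSubBoxOp` — THE OPERATOR OF A BOUNDARY PIECE «Ã_j = A» ON A SUB-BOX OF THE (Higgs)₂,₃ TORUS IS, ALONG THE
# SUB-BOX CHART, THE BOX OPERATOR `H(□, A)` OF THE CELL'S LEMMA-2.2 LINEAGE AT THE COMPONENT FIELD ITSELF (no bumps, no collar):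
# the field dictionary `compField (acT)`, the intertwining identity, `G ↔ greenA`, `K_jG h_j ↔ kOp·greenA·mulH`
# ([Balaban1983RegularityDecay] §2 p. 575 «if □_j intersects the boundary of Ω, then Ã_j = A», p. 579 «we can apply Lemma 2.2 to all
# operators in it»; [Balaban1982Higgs1] (2.20), Prop. 2.1 p. 611 l.1–2)

statement-level skeleton of published theorems with citation tags; proofs where landed; nothing here is a claim about the Yang–Mills mass gap

CITATION HEADER (lean-in-tree rule).  T. Bałaban, *Regularity and decay of lattice Green's functions*, Commun. Math. Phys. **89** (1983)
571–597 [Balaban1983RegularityDecay] ((1.2)–(1.6) p. 572 the operator, §2 p. 575 the pieces `□_j` and «Ã_j = A», p. 579 the parallelepiped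
sentence, p. 584 the box) and T. Bałaban, *(Higgs)₂,₃ quantum fields in a finite volume. I*, Commun. Math. Phys. **85** (1982) 603–626
[Balaban1982Higgs1] ((1.7) p. 605 `U(A) = exp(qεeA)`, (2.20) p. 610, Prop. 2.1 pp. 610–611).  PDF held: `paper:balaban1983-cmp89-regularity-decay`
pp. 575, 579 (`p0005.txt`, `p0009.txt`), `paper:balaban1982-cmp85-higgs23-i` p. 611 (`p0009.txt`), re-read by this seat.  Cell `lit-balaban`,
Phase-2 proof seat **p35** gen 15 (unit `lit-balaban-p35`); SKELETON rows **B1.Prop2.1** / **B1.Eq2.25** (parallelepiped clause on the carrier)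
and **B4.Lem2.2** / **B4.Eq2.18** (the per-piece inputs (2.17)/(2.20) on the SUB-BOXES of the (Higgs)₂,₃ torus).  USED BY NAME, never
restated: gen 8's `B1TorusCubeBoxOp.{flowC, ellC, ofLp_U, ofLp_star_U, acT, fld_covLap_boxWt, sum_nbrs_box, mesh_sq_ratio, pow_weight_cancel,
pow_le_sites, aSeq_nonneg_model}`, `B1TorusCubeChart`, `B1TorusCubeCover.hTor`, this seat's gen-15 `B1TorusSubBoxChart`, the typer's
`HiggsCovariance.{covLaplacianN, projPk, covOpK, propagatorK}`, `HiggsCovariancePos.covOpK_propagatorK_apply`, r01's `B4GaugeCovariance`,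
`B4Lemma22ReduceZero.{Box, opA, greenA}`, `B4Lemma22Invertible.greenA_mul_opA`, `B4Eq220CommutatorField.{kOp, kOp_eq_opA}`,
`B4Eq220PartitionSizes.{hZ, hBox}`, `B4Commutators25to211.{mulH, fld_mulH_mulVec}`, `B4Lower18RegularRegion.{compField, compField_add}`.

WHAT IS PRINTED.  [B4] p. 575 [PDF 5] L22–24, verbatim: *«where the configurations Ã_j are constructed in the following way: if □_j
intersects the boundary of Ω, then Ã_j = A; if □_j is an interior cube of Ω, then we take Ã_j as equal to A on the cube
{x : |x − Mj| ≦ (3/4)M}, and changing regularly to a constant function in a neighbourhood of a boundary of □_j.»*; p. 579 [PDF 9] L25–28,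
verbatim: *«Finally let us notice that if Ω is a rectangular parallelepiped, then all □_j in the representation (2.13) are cubes and we
can apply Lemma 2.2 to all operators in it, so the restriction dist({x, x′}, Ωᶜ) ≧ R₀ is unnecessary.»*; [B1] p. 611 [PDF 9] l.1–2: *«For
some simple sets Ω, e.g. for rectangular parallelepipeds, the inequalities hold without any restrictions on the points x, x′.»*  (v1.1, p35
gen 17: the p. 575 Ã_j sentence re-set verbatim from the text layer `p0005.txt` L22–24 and the render `1983-cmp89-regularity-decay-p005-x2.png`
— v1.0 carried a paraphrase inside guillemets, ref-4 S-B1-g54-1 (b); the p. 579 sentence completed; no declaration changed.)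

WHAT THIS FILE PROVES (kernel-checked, zero `sorry`; definitions with bodies + theorems; no `def … : Prop` fact).
* §1 `bondB K K₀ j Mb σ A` (the B4 bond function `compField (acT)` on the sub-box: the torus field ITSELF along the chart, scale `σ`),
  `bondB_antisymm`, `bondB_fwd` / `bondB_bwd` (`κ·bondB(y, y ± e_i) = ±εe·A`, `κσ = εe`).
* §2 **`covLap_pullB`** (`−Δ_{U(κ·bondB)}(pullB ψ) = pullB((L^Kε)²·(−Δ^{ε,N}_{A,boxT})ψ)`), `contourTrans_gammaB` (the transporters of the
  sub-box contour system are the model's `U(A(Γ^{(K)}_{x_K,x}))`), **`projOp_pullB`** (`Q^*Q(pullB ψ) = n^d·pullB(P_K(A)ψ)`).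
* §3 `boxOpB`, **`opA_mulVec_pullB`** — THE INTERTWINING: `H(□, bondB)(pullB ψ) = pullB((L^Kε)²·H_{boxT,A} ψ)` for EVERY `ψ`,
  `H_{boxT,A} = −Δ^{ε,N}_{A,boxT} + m² + a_K(L^Kε)^{−2}P_K(A)` = `covOpK C (boxT j Mb) A m² a K`.
* §4 **`pullB_propagatorK`** (`pullB(G^ε_K(boxT, A)φ) = (L^Kε)²·greenA·pullB φ`), `pullB_hsmul_of` (`pullB(h·u) = mulH(hBox jl)·pullB u` for
  a torus bump `h` that reads `hZ n K₀ jl` along the chart), **`pullB_commutator_of`** (`pullB(H(hu) − hHu) = −(L^Kε)^{−2}·kOp·pullB u`).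
* §5 `covOpK_boxT_supported`, `propagatorK_boxT_supported`, `smul_ofLp_covDeriv_toT_sub` (the bond dictionary for `D^ε_A`), and
  **`subbox_inputs`** — THE PER-PIECE INPUTS AT A BOUNDARY PIECE: for `h·ψ` supported in the sub-box, `‖G^ε_K(boxT, A)(hψ)‖_∞ ≤ C_γ(L^Kε)²‖ψ‖_∞`,
  `‖D^ε_A G^ε_K(boxT, A)(hψ)‖ ≤ C_γ(L^Kε)‖ψ‖_∞` on the bonds of the sub-box, and (2.20) `‖[H_{boxT,A}, h]G^ε_K(boxT, A)(hψ)‖_∞ ≤ (C_β/K₀)‖ψ‖_∞`,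
  at every `A` that is (2.23)-regular on the sub-box (gen 11's scaled form along the chart), `e_K ≤ e₁(K₀)`; from this seat's
  `B4Lemma22NoCollarContours.{lemma22_sup_noCollar_contour, eq220_noCollar_contour}` along `gammaB` through §2–§4.
HONEST SCOPE.  (i) Hypotheses `K ≤ K_P`, `K ≥ 1`, `K₀ ∣ M_P`, `K₀ ≥ 8`, `3M ≤ |T_ε|_μ`, `K₀ ∣ Mb_i`, `Mb_i ≤ 2K₀`, `L ≥ 2`, `m² > 0` with
`m²(L^Kε)² ≤ m²₊`, `a ∈ [a₋, a₊]`, `a₋ > 0`; (ii) the bump `h` of §4–§5 is any torus function with a chart representation `hZ n K₀ jl` on the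
sub-box (for the pieces of a box region it is `h_{j₀}` of a NEIGHBOURING window label — `B1Ineq225RegularBox`); (iii) constants `C_γ, C_β`
depend on `(d, L, a₋, a₊, m²₊, N, (e,q))` only, `e₁` also on `(c, β, K₀)` — existential, not optimised; (iv) the (I.2.25) members themselves
(the random walk over the pieces) are `B1Ineq225RegularBox`.
Unit `lit-balaban-p35` gen 15 (literature-prover-lit-balaban-p35-g15-0).
-/

open scoped BigOperators Matrix

noncomputable section

namespace Literature.MathematicalPhysics.QuantumFieldTheory.Balaban1983to89.B1TorusSubBoxOp

open Literature.MathematicalPhysics.QuantumFieldTheory.Balaban1983to89.HiggsLattice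
open Literature.MathematicalPhysics.QuantumFieldTheory.Balaban1983to89.HiggsAveraging
open Literature.MathematicalPhysics.QuantumFieldTheory.Balaban1983to89.HiggsCovariance
open Literature.MathematicalPhysics.QuantumFieldTheory.Balaban1983to89.HiggsCovariancePos
  (shift_unshift unshift_shift isUnit_covOpK covOpK_mul_propagatorK covOpK_propagatorK_apply)
open Literature.MathematicalPhysics.QuantumFieldTheory.Balaban1983to89.B1TorusCubeCover
open Literature.MathematicalPhysics.QuantumFieldTheory.Balaban1983to89.B1TorusCubeLocality26
open Literature.MathematicalPhysics.QuantumFieldTheory.Balaban1983to89.B1TorusCubeChart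
open Literature.MathematicalPhysics.QuantumFieldTheory.Balaban1983to89.B1TorusCubeContours
open Literature.MathematicalPhysics.QuantumFieldTheory.Balaban1983to89.B1TorusCubeBoxOp (flowC ellC ellC_nonneg flowC_lipschitz ofLp_U
  ofLp_star_U acT fld_covLap_boxWt sum_nbrs_box mesh_sq_ratio pow_weight_cancel pow_le_sites aSeq_nonneg_model blk_predL)
open Literature.MathematicalPhysics.QuantumFieldTheory.Balaban1983to89.B1TorusSubBoxChart
open Literature.MathematicalPhysics.QuantumFieldTheory.Balaban1983to89.B4GaugeCovariance
open Literature.MathematicalPhysics.QuantumFieldTheory.Balaban1983to89.B4Commutators25to211 (mulH fld_mulH_mulVec)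
open Literature.MathematicalPhysics.QuantumFieldTheory.Balaban1983to89.B4Reflection242 (boxDom mem_boxDom blk nbrs mem_nbrs
  nbrs_comm blk_mem_boxDom)
open Literature.MathematicalPhysics.QuantumFieldTheory.Balaban1983to89.B4Lower18Regular (e1 e1_apply_self e1_apply_ne
  lsum PathRel baseEmb blkWt_ne_zero)
open Literature.MathematicalPhysics.QuantumFieldTheory.Balaban1983to89.B4Lower18RegularRegion (compField compField_add e1_inj)
open Literature.MathematicalPhysics.QuantumFieldTheory.Balaban1983to89.B4Lemma21Region (siteNorm)
open Literature.MathematicalPhysics.QuantumFieldTheory.Balaban1983to89.B4Lemma22Reduce231 (supN le_supN supN_le supN_nonneg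
  siteNorm_nonneg siteNorm_smul)
open Literature.MathematicalPhysics.QuantumFieldTheory.Balaban1983to89.B4Lemma22PertVSup (contourTrans_fieldLink
  fld_avgOp_transpose_mulVec supN_neg supN_smul_le)
open Literature.MathematicalPhysics.QuantumFieldTheory.Balaban1983to89.B4Lemma22ReduceZero (derivA)
open Literature.MathematicalPhysics.QuantumFieldTheory.Balaban1983to89.B4Lemma22NoCollarContours (lemma22_sup_noCollar_contour
  eq220_noCollar_contour)
open Literature.MathematicalPhysics.QuantumFieldTheory.Balaban1983to89.B4Lemma22ReduceZero (Box opA greenA)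
open Literature.MathematicalPhysics.QuantumFieldTheory.Balaban1983to89.B4Lemma22Invertible (opA_isUnit_det greenA_mul_opA)
open Literature.MathematicalPhysics.QuantumFieldTheory.Balaban1983to89.B4Eq220PartitionSizes (hZ hBox)
open Literature.MathematicalPhysics.QuantumFieldTheory.Balaban1983to89.B4Eq220CommutatorField (kOp kOp_eq_opA)

variable {P : HiggsLattice.Params} {N : ℕ}

/-- `K₀ ≥ 8 ⇒ K₀ ≥ 1`. [folklore] -/
private theorem one_le_of_eight_le {K₀ : ℕ} (hK₀8 : 8 ≤ K₀) : 1 ≤ K₀ := le_trans (by norm_num) hK₀8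

/-! ## §1 The field dictionary on a boundary piece: `Ã_j = A` along the sub-box chart -/

section Field

variable (K K₀ : ℕ)

/-- **THE BOND FUNCTION OF A BOUNDARY PIECE** «Ã_j = A»: the lineage's component bond function of `acT σ A` (the torus field itself, scale
`σ`, read along the chart) on the sub-box `Π[0, L^K Mb_i)`. [cite: Balaban1983RegularityDecay, §2 p.575] -/
def bondB (j : Lab P K K₀) (Mb : Fin (dd P + 1) → ℕ) (σ : ℝ) (A : HiggsLattice.VecField P 0) :
    ↥(Box (dd P) (P.L - 1) K Mb) → ↥(Box (dd P) (P.L - 1) K Mb) → ℝ :=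
  fun u v => compField (acT K K₀ j σ A) u.1 v.1

variable {K K₀}

/-- The bond function is antisymmetric («A_b̄ = −A_b»). [cite: Balaban1983RegularityDecay, p.576] -/
theorem bondB_antisymm (j : Lab P K K₀) (Mb : Fin (dd P + 1) → ℕ) (σ : ℝ) (A : HiggsLattice.VecField P 0)
    (u v : ↥(Box (dd P) (P.L - 1) K Mb)) : bondB K K₀ j Mb σ A v u = -bondB K K₀ j Mb σ A u v := by
  unfold bondB compField
  ring

/-- **THE FIELD DICTIONARY ON FORWARD BONDS**: `κ·bondB(u, u + e_i) = εe·A(⟨toT u, i⟩)` when `κσ = εe`. [cite: Balaban1983RegularityDecay, (1.2) p.572] -/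
theorem bondB_fwd (j : Lab P K K₀) (Mb : Fin (dd P + 1) → ℕ) {κ σ : ℝ} (C : ChargeData N) (hκσ : κ * σ = P.mesh 0 * C.e)
    (A : HiggsLattice.VecField P 0) {u v : ↥(Box (dd P) (P.L - 1) K Mb)} {i : Fin (dd P + 1)} (huv : v.1 = u.1 + e1 i) :
    κ * bondB K K₀ j Mb σ A u v = P.mesh 0 * C.e * A ⟨toT K K₀ j u.1, castD P i⟩ := by
  unfold bondB
  rw [huv, compField_add]
  unfold acT
  rw [← mul_assoc, hκσ]

/-- `κ·bondB(v + e_i ↦ v)`: the backward bond carries `−εe·A(⟨toT v, i⟩)`. [cite: Balaban1983RegularityDecay, p.576 «A_b̄ = −A_b»] -/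
theorem bondB_bwd (j : Lab P K K₀) (Mb : Fin (dd P + 1) → ℕ) {κ σ : ℝ} (C : ChargeData N) (hκσ : κ * σ = P.mesh 0 * C.e)
    (A : HiggsLattice.VecField P 0) {u v : ↥(Box (dd P) (P.L - 1) K Mb)} {i : Fin (dd P + 1)} (huv : u.1 = v.1 + e1 i) :
    κ * bondB K K₀ j Mb σ A u v = -(P.mesh 0 * C.e * A ⟨toT K K₀ j v.1, castD P i⟩) := by
  rw [bondB_antisymm, mul_neg, bondB_fwd j Mb C hκσ A huv]

/-- The raw forward-bond identity on plain vectors (for the contour dictionary): `compField (acT σ A) z (z + e_i) = σ·A(⟨toT z, i⟩)`.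
[cite: Balaban1982Higgs1, (2.3) p.608] -/
theorem compField_acT_step (j : Lab P K K₀) (σ : ℝ) (A : HiggsLattice.VecField P 0) (z : Fin (dd P + 1) → ℤ) (i : Fin (dd P + 1)) :
    compField (acT K K₀ j σ A) z (z + e1 i) = σ * A ⟨toT K K₀ j z, castD P i⟩ := by
  rw [compField_add]; rfl

end Field

/-! ## §2 The three parts of the intertwining: Laplacian, contours, averaging -/

section Parts

variable {K K₀ : ℕ}

/-- **(T1) THE LAPLACIAN PART**: `−Δ_{U(κ·bondB)}(pullB ψ) = pullB((L^Kε)²·(−Δ^{ε,N}_{A,boxT})ψ)`.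
[cite: Balaban1983RegularityDecay, (1.3) p.572] [cite: Balaban1982Higgs1, (2.17) p.610] -/
theorem covLap_pullB (C : ChargeData N) (hK : K ≤ P.K) (hK₀ : K₀ ∣ P.M) (hK₀8 : 8 ≤ K₀)
    (hN3 : ∀ μ, 3 * half P K K₀ ≤ P.sitesPerDir 0 μ) (j : Lab P K K₀) {Mb : Fin (dd P + 1) → ℕ} (hMb : ∀ i, Mb i ≤ 2 * K₀)
    {κ σ : ℝ} (hκσ : κ * σ = P.mesh 0 * C.e) (A : HiggsLattice.VecField P 0) (ψ : HiggsLattice.ScalarField P 0 N)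
    (z : ↥(Box (dd P) (P.L - 1) K Mb)) :
    fld (covLap (boxWt ((P.L - 1 + 1) ^ K) (fun i => (P.L - 1 + 1) ^ K * Mb i))
        (fieldLink (flowC C) κ (bondB K K₀ j Mb σ A)) *ᵥ pullB K K₀ j Mb ψ) z
      = fld (pullB K K₀ j Mb ((P.mesh K ^ 2) • covLaplacianN C (boxT K K₀ j Mb) A ψ)) z := by
  have hanti : ∀ u v : ↥(Box (dd P) (P.L - 1) K Mb), bondB K K₀ j Mb σ A v u = -bondB K K₀ j Mb σ A u v :=
    fun u v => bondB_antisymm j Mb σ A u v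
  rw [fld_covLap_boxWt (flowC C) κ (bondB K K₀ j Mb σ A) hanti (pullB K K₀ j Mb ψ) z]
  -- the summand factors through the underlying points
  set x : HiggsLattice.Site P 0 := toT K K₀ j z.1 with hx
  set g : (Fin (dd P + 1) → ℤ) → (Fin N → ℝ) := fun w =>
    WithLp.ofLp (ψ x) - (flowC C).U (κ * compField (acT K K₀ j σ A) z.1 w) *ᵥ WithLp.ofLp (ψ (toT K K₀ j w)) with hg
  have hsum : ∀ z' : ↥(Box (dd P) (P.L - 1) K Mb),
      (if z'.1 ∈ nbrs z.1 then (fld (pullB K K₀ j Mb ψ) z - fieldLink (flowC C) κ (bondB K K₀ j Mb σ A) z z' *ᵥ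
        fld (pullB K K₀ j Mb ψ) z') else 0) = (if z'.1 ∈ nbrs z.1 then g z'.1 else 0) := by
    intro z'; split_ifs
    · rfl
    · rfl
  rw [Finset.sum_congr rfl (fun z' _ => hsum z'), sum_nbrs_box z.1 g]
  -- the torus side
  rw [fld_pullB_ofLp, Pi.smul_apply, covLaplacianN_apply, WithLp.ofLp_smul, WithLp.ofLp_smul, smul_smul,
    mesh_sq_ratio, WithLp.ofLp_sum, ← (castD P).sum_comp]
  congr 1
  refine Finset.sum_congr rfl fun i _ => ?_
  rw [WithLp.ofLp_add, fwdTerm_apply, bwdTerm_apply]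
  have hxc : x ∈ boxT K K₀ j Mb := toT_mem_boxT hK hK₀ hK₀8 j hMb z.2
  congr 1
  · -- forward bond
    rw [← hx]
    by_cases hb : z.1 + e1 i ∈ Box (dd P) (P.L - 1) K Mb
    · have hs : x.shift (castD P i) ∈ boxT K K₀ j Mb := (add_e1_mem_boxB_iff hK hK₀ hK₀8 hN3 j hMb z.2 i).1 hb
      rw [if_pos hb, if_pos ⟨hxc, hs⟩, hg]
      simp only
      rw [WithLp.ofLp_sub, ofLp_U, ← toT_add_e1, hx]
      congr 3
      have := bondB_fwd j Mb C hκσ A (u := z) (v := ⟨z.1 + e1 i, hb⟩) rfl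
      unfold bondB at this
      exact this
    · have hs : x.shift (castD P i) ∉ boxT K K₀ j Mb := fun h => hb ((add_e1_mem_boxB_iff hK hK₀ hK₀8 hN3 j hMb z.2 i).2 h)
      rw [if_neg hb, if_neg (fun h => hs h.2), WithLp.ofLp_zero]
  · -- backward bond
    rw [← hx]
    by_cases hb : z.1 - e1 i ∈ Box (dd P) (P.L - 1) K Mb
    · have hs : x.unshift (castD P i) ∈ boxT K K₀ j Mb := (sub_e1_mem_boxB_iff hK hK₀ hK₀8 hN3 j hMb z.2 i).1 hb
      rw [if_pos hb, if_pos ⟨hxc, hs⟩, hg]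
      simp only
      rw [WithLp.ofLp_sub, ofLp_star_U, ← toT_sub_e1, hx, (flowC C).transpose_eq]
      congr 3
      have := bondB_bwd j Mb C hκσ A (u := z) (v := ⟨z.1 - e1 i, hb⟩) (i := i) (by simp)
      unfold bondB at this
      exact this
    · have hs : x.unshift (castD P i) ∉ boxT K K₀ j Mb :=
        fun h => hb ((sub_e1_mem_boxB_iff hK hK₀ hK₀8 hN3 j hMb z.2 i).2 h)
      rw [if_neg hb, if_neg (fun h => hs h.2), WithLp.ofLp_zero]

/-- **THE TRANSPORTERS OF THE SUB-BOX CONTOUR SYSTEM ARE THE MODEL'S `U(A(Γ^{(K)}_{x_K,x}))`** (for `x ∈ B^K(y)`).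
[cite: Balaban1983RegularityDecay, (1.4) p.572] [cite: Balaban1982Higgs1, (2.11) p.609] -/
theorem contourTrans_gammaB (C : ChargeData N) (hK : K ≤ P.K) (hK₀8 : 8 ≤ K₀)
    (hN3 : ∀ μ, 3 * half P K K₀ ≤ P.sitesPerDir 0 μ) (j : Lab P K K₀) {Mb : Fin (dd P + 1) → ℕ} {κ σ : ℝ}
    (hκσ : κ * σ = P.mesh 0 * C.e) (A : HiggsLattice.VecField P 0) (y : ↥(boxDom Mb)) (x : ↥(Box (dd P) (P.L - 1) K Mb))
    (h : blk ((P.L - 1 + 1) ^ K) x.1 = y.1) :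
    contourTrans (fieldLink (flowC C) κ (bondB K K₀ j Mb σ A)) (baseEmb (one_le_n P K) Mb) (gammaB P K Mb) y x
      = (flowC C).U (P.mesh 0 * C.e * multiContourSum A K (toT K K₀ j x.1)) := by
  rw [contourTrans_fieldLink]
  rw [blk_predL] at h
  rw [lsum_gammaB hK (pow_le_sites (one_le_of_eight_le hK₀8) hN3) j A σ (bondB K K₀ j Mb σ A) (compField (acT K K₀ j σ A))
    (fun u v => rfl) (fun z _ i => compField_acT_step j σ A z i) y x h, ← mul_assoc, hκσ]

/-- **(T3) THE AVERAGING PART**: `Q^*Q(pullB ψ) = n^{d}·pullB(P_K(A)ψ)` (unit block weights on the box against `L^{−Kd}` on the torus).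
[cite: Balaban1983RegularityDecay, (1.4)–(1.5) p.572] [cite: Balaban1982Higgs1, (2.20) p.610] -/
theorem projOp_pullB (C : ChargeData N) (hK : K ≤ P.K) (hK₀ : K₀ ∣ P.M) (hK₀8 : 8 ≤ K₀)
    (hN3 : ∀ μ, 3 * half P K K₀ ≤ P.sitesPerDir 0 μ) (j : Lab P K K₀) {Mb : Fin (dd P + 1) → ℕ} (hMb : ∀ i, Mb i ≤ 2 * K₀)
    {κ σ : ℝ} (hκσ : κ * σ = P.mesh 0 * C.e) (A : HiggsLattice.VecField P 0) (ψ : HiggsLattice.ScalarField P 0 N)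
    (z : ↥(Box (dd P) (P.L - 1) K Mb)) :
    fld (projOp (blkWt ((P.L - 1 + 1) ^ K) Mb (fun i => (P.L - 1 + 1) ^ K * Mb i))
        (contourTrans (fieldLink (flowC C) κ (bondB K K₀ j Mb σ A)) (baseEmb (one_le_n P K) Mb) (gammaB P K Mb))
        *ᵥ pullB K K₀ j Mb ψ) z
      = fld (pullB K K₀ j Mb (((((P.L - 1 + 1) ^ K : ℕ) : ℝ) ^ (dd P + 1)) • projPk C A K ψ)) z := by
  classical
  have hK₀' : 1 ≤ K₀ := one_le_of_eight_le hK₀8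
  set n : ℕ := (P.L - 1 + 1) ^ K with hn
  set T := contourTrans (fieldLink (flowC C) κ (bondB K K₀ j Mb σ A)) (baseEmb (one_le_n P K) Mb) (gammaB P K Mb) with hT
  set x : HiggsLattice.Site P 0 := toT K K₀ j z.1 with hx
  set t : HiggsLattice.Site P 0 → ℝ := fun w => P.mesh 0 * C.e * multiContourSum A K w with ht
  have hT' : ∀ (y : ↥(boxDom Mb)) (z' : ↥(Box (dd P) (P.L - 1) K Mb)), blk n z'.1 = y.1 →
      T y z' = (flowC C).U (t (toT K K₀ j z'.1)) := fun y z' h => contourTrans_gammaB C hK hK₀8 hN3 j hκσ A y z' h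
  set yz : ↥(boxDom Mb) := ⟨blk n z.1, blk_mem_boxDom (one_le_n P K) z.2⟩ with hyz
  -- the box side
  rw [projOp, ← Matrix.mulVec_mulVec, fld_avgOp_transpose_mulVec]
  rw [Finset.sum_eq_single yz ?_ (fun h => absurd (Finset.mem_univ yz) h)]
  swap
  · intro y₀ _ hy₀
    have : blkWt n Mb (fun i => n * Mb i) y₀ z = 0 := by
      unfold blkWt; rw [if_neg]; intro h; exact hy₀ (Subtype.ext h.symm)
    rw [this, zero_smul]
  have hq : blkWt n Mb (fun i => n * Mb i) yz z = 1 := by unfold blkWt; rw [if_pos rfl]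
  rw [hq, one_smul, fld_avgOp_mulVec, hT' yz z rfl]
  have hterm : ∀ z' : ↥(Box (dd P) (P.L - 1) K Mb),
      blkWt n Mb (fun i => n * Mb i) yz z' • (T yz z' *ᵥ fld (pullB K K₀ j Mb ψ) z')
        = if blk n z'.1 = blk n z.1 then (flowC C).U (t (toT K K₀ j z'.1)) *ᵥ WithLp.ofLp (ψ (toT K K₀ j z'.1)) else 0 := by
    intro z'
    unfold blkWt
    by_cases h : blk n z'.1 = blk n z.1
    · rw [if_pos h, if_pos h, one_smul, hT' yz z' h, fld_pullB_ofLp]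
    · rw [if_neg h, if_neg h, zero_smul]
  rw [Finset.sum_congr rfl (fun z' _ => hterm z')]
  -- the torus side
  rw [fld_pullB_ofLp, Pi.smul_apply, WithLp.ofLp_smul, projPk_apply, ofLp_star_U, WithLp.ofLp_smul, Matrix.mulVec_smul,
    smul_smul, pow_weight_cancel, one_smul, WithLp.ofLp_sum]
  simp_rw [ofLp_U]
  congr 1
  -- the block sums correspond under the chart
  rw [← Finset.sum_filter]
  refine Finset.sum_bij' (fun z' _ => toT K K₀ j z'.1) (fun x' hx' => ⟨fromT K K₀ j x', ?_⟩) ?_ ?_ ?_ ?_ ?_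
  · -- `x' ∈ B^K(x_K)` lies in the sub-box (a union of `K`-blocks)
    rw [mem_blockK] at hx'
    exact mem_boxT_iff.1 (mem_boxT_of_blockIter_eq hK hK₀ hK₀8 hN3 j hMb (toT_mem_boxT hK hK₀ hK₀8 j hMb z.2) hx')
  · intro z' hz'
    rw [Finset.mem_filter] at hz'
    rw [mem_blockK]
    have : blk (nK P K) z'.1 = blk (nK P K) z.1 := by rw [← blk_predL, ← blk_predL]; exact hz'.2
    exact (blockIter_toT_eq_iff_sub hK hN3 j hMb z'.2 z.2).2 this
  · intro x' hx'
    rw [Finset.mem_filter]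
    refine ⟨Finset.mem_univ _, ?_⟩
    rw [mem_blockK] at hx'
    have hmem := mem_boxT_iff.1 (mem_boxT_of_blockIter_eq hK hK₀ hK₀8 hN3 j hMb (toT_mem_boxT hK hK₀ hK₀8 j hMb z.2) hx')
    have := (blockIter_toT_eq_iff_sub hK hN3 j hMb hmem z.2).1 (by rw [toT_fromT]; exact hx')
    show blk n (fromT K K₀ j x') = blk n z.1
    rw [hn, blk_predL, blk_predL]; exact this
  · intro z' hz'; exact Subtype.ext (fromT_toT_of_mem hK hK₀ hK₀' j (box_subset_M2 hMb z'.2))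
  · intro x' hx'; exact toT_fromT j x'
  · intro z' hz'; rfl

end Parts

/-! ## §3 The intertwining identity `H(□, bondB)·pullB = pullB·(L^Kε)²H_{boxT,A}` -/

section Intertwine

variable {K K₀ : ℕ}

/-- THE BOX OPERATOR OF A PIECE in the lineage: `H(□, bondB)` with [B4]'s weights, the flow `e^{tq}`, coupling `κ`, mass `m²(L^Kε)²`
and the composite-contour system `gammaB`. [cite: Balaban1983RegularityDecay, (1.6) p.572] -/
abbrev boxOpB (C : ChargeData N) (K K₀ : ℕ) (j : Lab P K K₀) (Mb : Fin (dd P + 1) → ℕ) (κ σ a msq : ℝ) (A : HiggsLattice.VecField P 0) :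
    Matrix (↥(Box (dd P) (P.L - 1) K Mb) × Fin N) (↥(Box (dd P) (P.L - 1) K Mb) × Fin N) ℝ :=
  opA (dd P) (flowC C) κ (P.L - 1) K a (msq * P.mesh K ^ 2) Mb (baseEmb (one_le_n P K) Mb) (gammaB P K Mb) (bondB K K₀ j Mb σ A)

/-- **THE INTERTWINING IDENTITY**: along the sub-box chart the lineage's box operator at the field itself is `(L^Kε)²` times the model's
piece operator of (2.20): `H(□, bondB)(pullB ψ) = pullB((L^Kε)²·(−Δ^{ε,N}_{A,boxT} + m² + a_K(L^Kε)^{−2}P_K(A))ψ)` for EVERY `ψ`.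
[cite: Balaban1983RegularityDecay, (1.6) p.572] [cite: Balaban1982Higgs1, (2.20), (2.22) p.610] -/
theorem opA_mulVec_pullB (C : ChargeData N) (hK : K ≤ P.K) (hK₀ : K₀ ∣ P.M) (hK₀8 : 8 ≤ K₀)
    (hN3 : ∀ μ, 3 * half P K K₀ ≤ P.sitesPerDir 0 μ) (j : Lab P K K₀) {Mb : Fin (dd P + 1) → ℕ} (hMb : ∀ i, Mb i ≤ 2 * K₀)
    {κ σ : ℝ} (hκσ : κ * σ = P.mesh 0 * C.e) (a msq : ℝ) (A : HiggsLattice.VecField P 0) (ψ : HiggsLattice.ScalarField P 0 N) :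
    boxOpB C K K₀ j Mb κ σ a msq A *ᵥ pullB K K₀ j Mb ψ
      = pullB K K₀ j Mb ((P.mesh K ^ 2) • covOpK C (boxT K K₀ j Mb) A msq a K ψ) := by
  have hm : P.mesh K ≠ 0 := by
    have : 0 < P.mesh K := by unfold HiggsLattice.Params.mesh; have := P.hε; have := P.hL; positivity
    exact this.ne'
  have hn : ((((P.L - 1 + 1) ^ K : ℕ)) : ℝ) ≠ 0 := by have := P.hL; positivity
  have hL : ((P.L - 1 : ℕ) : ℝ) + 1 = (P.L : ℝ) := by
    have := predL_succ P; exact_mod_cast this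
  funext p
  obtain ⟨z, i⟩ := p
  have e1 := congrFun (covLap_pullB C hK hK₀ hK₀8 hN3 j hMb hκσ A ψ z) i
  have e3 := congrFun (projOp_pullB C hK hK₀ hK₀8 hN3 j hMb hκσ A ψ z) i
  simp only [fld_apply] at e1 e3
  simp only [boxOpB, opA, b4Op, covOp, Matrix.add_mulVec, Matrix.smul_mulVec, Matrix.one_mulVec, Pi.add_apply,
    Pi.smul_apply, e1, e3, smul_eq_mul]
  simp only [pullB, covOpK, LinearMap.add_apply, LinearMap.smul_apply, LinearMap.id_apply, Pi.add_apply, Pi.smul_apply,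
    smul_eq_mul, PiLp.add_apply, PiLp.smul_apply, hL]
  field_simp

end Intertwine

/-! ## §4 `G ↔ greenA` and the commutator dictionary for a bump read along the chart -/

section GreenDict

variable {K K₀ : ℕ}

/-- **`G^ε_K(boxT, A)` ALONG THE CHART IS `(L^Kε)²·G(□, bondB)`**: `pullB(Gφ) = (L^Kε)²·greenA·pullB φ` for every `φ`.
[cite: Balaban1983RegularityDecay, (1.6) p.572] [cite: Balaban1982Higgs1, (2.22) p.610] -/
theorem pullB_propagatorK (C : ChargeData N) (hK : K ≤ P.K) (hK1 : 1 ≤ K) (hK₀ : K₀ ∣ P.M) (hK₀8 : 8 ≤ K₀)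
    (hN3 : ∀ μ, 3 * half P K K₀ ≤ P.sitesPerDir 0 μ) (hL2 : 2 ≤ P.L) (j : Lab P K K₀) {Mb : Fin (dd P + 1) → ℕ}
    (hMb : ∀ i, Mb i ≤ 2 * K₀) {κ σ : ℝ} (hκσ : κ * σ = P.mesh 0 * C.e) {a msq : ℝ} (ha : 0 < a) (hmsq : 0 < msq)
    (A : HiggsLattice.VecField P 0) (φ : HiggsLattice.ScalarField P 0 N) :
    pullB K K₀ j Mb (propagatorK C (boxT K K₀ j Mb) A msq a K φ)
      = (P.mesh K ^ 2) • (greenA (dd P) (flowC C) κ (P.L - 1) K a (msq * P.mesh K ^ 2) Mb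
          (baseEmb (one_le_n P K) Mb) (gammaB P K Mb) (bondB K K₀ j Mb σ A) *ᵥ pullB K K₀ j Mb φ) := by
  have hak : 0 ≤ B1.aSeq a P.L K := aSeq_nonneg_model hL2 ha hK1
  have hℓ : 1 ≤ P.L - 1 := by omega
  have hm2 : 0 ≤ msq * P.mesh K ^ 2 := by positivity
  have h1 := opA_mulVec_pullB C hK hK₀ hK₀8 hN3 j hMb hκσ a msq A (propagatorK C (boxT K K₀ j Mb) A msq a K φ)
  rw [covOpK_propagatorK_apply C _ _ hmsq a K hak] at h1
  have hinv := greenA_mul_opA (flowC C) κ hℓ hK1 ha hm2 Mb (fun y x _ => gammaB_nn y x)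
    (fun y x h => gammaB_hend y x h) (bondB K K₀ j Mb σ A)
  have h2 := congrArg (fun v => greenA (dd P) (flowC C) κ (P.L - 1) K a (msq * P.mesh K ^ 2) Mb
    (baseEmb (one_le_n P K) Mb) (gammaB P K Mb) (bondB K K₀ j Mb σ A) *ᵥ v) h1
  rw [Matrix.mulVec_mulVec, hinv, Matrix.one_mulVec, pullB_smul, Matrix.mulVec_smul] at h2
  exact h2

/-- `pullB (h·ψ) = mulH(hBox jl)·pullB ψ` for a torus bump `h` that reads `hZ n K₀ jl` along the sub-box chart.
[cite: Balaban1983RegularityDecay, (2.9) p.576] -/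
theorem pullB_hsmul_of (j : Lab P K K₀) {Mb : Fin (dd P + 1) → ℕ} {h : HiggsLattice.Site P 0 → ℝ} {jl : Fin (dd P + 1) → ℤ}
    (hh : ∀ y ∈ Box (dd P) (P.L - 1) K Mb, h (toT K K₀ j y) = hZ ((P.L - 1 + 1) ^ K) K₀ jl y)
    (ψ : HiggsLattice.ScalarField P 0 N) :
    pullB K K₀ j Mb (h • ψ) = mulH (hBox ((P.L - 1 + 1) ^ K) K₀ Mb jl) *ᵥ pullB K K₀ j Mb ψ := by
  funext p
  obtain ⟨y, i⟩ := p
  have e := congrFun (fld_mulH_mulVec (ι := Fin N) (hBox ((P.L - 1 + 1) ^ K) K₀ Mb jl) (pullB K K₀ j Mb ψ) y) i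
  simp only [fld_apply] at e
  rw [e, Pi.smul_apply, fld_apply, pullB_hsmul, hh y.1 y.2, smul_eq_mul]
  rfl

/-- **THE COMMUTATOR ALONG THE CHART**: `pullB(H(hu) − hHu) = −(L^Kε)^{−2}·kOp(hBox jl)·pullB u` for every `u`, for a torus bump `h` that
reads `hZ n K₀ jl` along the sub-box chart (`H = H_{boxT,A}`). [cite: Balaban1983RegularityDecay, (2.7)–(2.10) p.576] -/
theorem pullB_commutator_of (C : ChargeData N) (hK : K ≤ P.K) (hK₀ : K₀ ∣ P.M) (hK₀8 : 8 ≤ K₀)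
    (hN3 : ∀ μ, 3 * half P K K₀ ≤ P.sitesPerDir 0 μ) (j : Lab P K K₀) {Mb : Fin (dd P + 1) → ℕ} (hMb : ∀ i, Mb i ≤ 2 * K₀)
    {κ σ : ℝ} (hκσ : κ * σ = P.mesh 0 * C.e) (a msq : ℝ) (A : HiggsLattice.VecField P 0)
    {h : HiggsLattice.Site P 0 → ℝ} {jl : Fin (dd P + 1) → ℤ}
    (hh : ∀ y ∈ Box (dd P) (P.L - 1) K Mb, h (toT K K₀ j y) = hZ ((P.L - 1 + 1) ^ K) K₀ jl y)
    (u : HiggsLattice.ScalarField P 0 N) :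
    pullB K K₀ j Mb (covOpK C (boxT K K₀ j Mb) A msq a K (h • u) - h • covOpK C (boxT K K₀ j Mb) A msq a K u)
      = -((P.mesh K ^ 2)⁻¹ • (kOp (flowC C) κ ((P.L - 1 + 1) ^ K) (B1.aSeq a (((P.L - 1 : ℕ) : ℝ) + 1) K)
          (msq * P.mesh K ^ 2) Mb (baseEmb (one_le_n P K) Mb) (gammaB P K Mb) (bondB K K₀ j Mb σ A)
          (hBox ((P.L - 1 + 1) ^ K) K₀ Mb jl) *ᵥ pullB K K₀ j Mb u)) := by
  have hs : P.mesh K ≠ 0 := by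
    have : 0 < P.mesh K := by unfold HiggsLattice.Params.mesh; have := P.hε; have := P.hL; positivity
    exact this.ne'
  rw [kOp_eq_opA, Matrix.sub_mulVec, ← Matrix.mulVec_mulVec, ← Matrix.mulVec_mulVec]
  change _ = -((P.mesh K ^ 2)⁻¹ • (mulH (hBox ((P.L - 1 + 1) ^ K) K₀ Mb jl)
      *ᵥ (boxOpB C K K₀ j Mb κ σ a msq A *ᵥ pullB K K₀ j Mb u)
      - boxOpB C K K₀ j Mb κ σ a msq A *ᵥ (mulH (hBox ((P.L - 1 + 1) ^ K) K₀ Mb jl) *ᵥ pullB K K₀ j Mb u)))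
  rw [← pullB_hsmul_of j hh u, opA_mulVec_pullB C hK hK₀ hK₀8 hN3 j hMb hκσ,
    opA_mulVec_pullB C hK hK₀ hK₀8 hN3 j hMb hκσ, ← pullB_hsmul_of j hh]
  funext p
  simp only [pullB, Pi.sub_apply, Pi.neg_apply, Pi.smul_apply, PiLp.sub_apply, PiLp.smul_apply, smul_eq_mul,
    Pi.smul_apply']
  field_simp
  ring

end GreenDict

/-! ## §5 Supports, the derivative dictionary, and the PER-PIECE INPUTS (2.17)/(2.20) at the field itself -/

section Inputs

variable {K K₀ : ℕ}

/-- The Euclidean site norm of the coordinate vector of `v ∈ ℝ^N` is `‖v‖`. [cite: Balaban1982Higgs1, (1.5) p.604] -/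
private theorem siteNorm_ofLp' (v : EuclideanSpace ℝ (Fin N)) : siteNorm (WithLp.ofLp v) = ‖v‖ := by
  rw [siteNorm, EuclideanSpace.norm_eq]
  congr 1
  simp only [dotProduct, Real.norm_eq_abs, sq, abs_mul_abs_self]

/-- `L^K ≥ 2` for `K ≥ 1`, `L ≥ 2`. [cite: Balaban1982Higgs1, (1.2) p.604] -/
private theorem two_le_n (hL2 : 2 ≤ P.L) (hK1 : 1 ≤ K) : 2 ≤ (P.L - 1 + 1) ^ K := by
  calc 2 ≤ P.L - 1 + 1 := by omega
    _ = (P.L - 1 + 1) ^ 1 := (pow_one _).symm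
    _ ≤ (P.L - 1 + 1) ^ K := Nat.pow_le_pow_right (by omega) hK1

/-- **`H_{boxT,A}` MAPS `boxT`-SUPPORTED FIELDS TO `boxT`-SUPPORTED FIELDS** (r14's `covOpK_indicator_comm` for the block union `boxT`).
[cite: Balaban1982Higgs1, (2.20) p.610] -/
theorem covOpK_boxT_supported (C : ChargeData N) (hK : K ≤ P.K) (hK₀ : K₀ ∣ P.M) (hK₀8 : 8 ≤ K₀)
    (hN3 : ∀ μ, 3 * half P K K₀ ≤ P.sitesPerDir 0 μ) (j : Lab P K K₀) {Mb : Fin (dd P + 1) → ℕ} (hMb : ∀ i, Mb i ≤ 2 * K₀)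
    (A : HiggsLattice.VecField P 0) (msq a : ℝ) {ψ : HiggsLattice.ScalarField P 0 N}
    (hψ : ∀ x, x ∉ boxT K K₀ j Mb → ψ x = 0) :
    ∀ x, x ∉ boxT K K₀ j Mb → covOpK C (boxT K K₀ j Mb) A msq a K ψ x = 0 := by
  intro x hx
  have hPi : (fun x => if x ∈ boxT K K₀ j Mb then ψ x else 0) = ψ := by
    funext x'
    split_ifs with h
    · rfl
    · exact (hψ x' h).symm
  have hc := B1Cor23RegularRegion.covOpK_indicator_comm C (boxT K K₀ j Mb) A (msq := msq) (a := a)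
    (boxT_blockSat hK hK₀ hK₀8 hN3 j hMb) ψ
  rw [hPi] at hc
  have hcx := congrFun hc x
  rw [hcx]
  exact if_neg hx

/-- **`G^ε_K(boxT, A)` MAPS `boxT`-SUPPORTED FIELDS TO `boxT`-SUPPORTED FIELDS** (`m² > 0`, `a_K ≥ 0`; r14's `propagatorK_supported`).
[cite: Balaban1982Higgs1, (2.20) p.610] -/
theorem propagatorK_boxT_supported (C : ChargeData N) (hK : K ≤ P.K) (hK₀ : K₀ ∣ P.M) (hK₀8 : 8 ≤ K₀)
    (hN3 : ∀ μ, 3 * half P K K₀ ≤ P.sitesPerDir 0 μ) (j : Lab P K K₀) {Mb : Fin (dd P + 1) → ℕ} (hMb : ∀ i, Mb i ≤ 2 * K₀)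
    (A : HiggsLattice.VecField P 0) {msq a : ℝ} (hmsq : 0 < msq) (hak : 0 ≤ B1.aSeq a P.L K)
    {ψ : HiggsLattice.ScalarField P 0 N} (hψ : ∀ x, x ∉ boxT K K₀ j Mb → ψ x = 0) :
    ∀ x, x ∉ boxT K K₀ j Mb → propagatorK C (boxT K K₀ j Mb) A msq a K ψ x = 0 :=
  B1Cor23RegularRegion.propagatorK_supported C (boxT K K₀ j Mb) A hmsq hak (boxT_blockSat hK hK₀ hK₀8 hN3 j hMb) ψ hψ

/-- `(L^Kε)·ε⁻¹ = L^K` (the lineage's `n = (L−1+1)^K`; gen 10's `B1TorusCubeDeriv.mesh_mul_inv_mesh_zero`, re-proved here so that this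
module does not import `B1TorusCubeDeriv`). [cite: Balaban1982Higgs1, (1.19) p.607] -/
private theorem mesh_ratio (P : HiggsLattice.Params) (K : ℕ) :
    P.mesh K * (P.mesh 0)⁻¹ = (((P.L - 1 + 1) ^ K : ℕ) : ℝ) := by
  rw [predL_succ]
  unfold HiggsLattice.Params.mesh
  have hε := P.hε
  push_cast
  field_simp

/-- **THE BOND DICTIONARY FOR `D^ε` ON A SUB-BOX**: `(L^Kε)·(D^ε_{A}u)(⟨toT z, e_i⟩) = (derivA_i·pullB u)(z)` for `z, z + e_i` in the sub-box
(the lineage's `derivA` with the flow `e^{tq}`, coupling `κ`, field `bondB`, `κσ = εe`).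
[cite: Balaban1983RegularityDecay, (1.3) p.572] [cite: Balaban1982Higgs1, (1.7) p.605] -/
theorem smul_ofLp_covDeriv_toT_sub (C : ChargeData N) (j : Lab P K K₀) {Mb : Fin (dd P + 1) → ℕ} {κ σ : ℝ}
    (hκσ : κ * σ = P.mesh 0 * C.e) (A : HiggsLattice.VecField P 0) (u : HiggsLattice.ScalarField P 0 N)
    (z : ↥(Box (dd P) (P.L - 1) K Mb)) (i : Fin (dd P + 1)) (hz : z.1 + e1 i ∈ Box (dd P) (P.L - 1) K Mb) :
    P.mesh K • WithLp.ofLp (covDeriv C A u ⟨toT K K₀ j z.1, castD P i⟩)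
      = fld (derivA (dd P) (flowC C) κ (P.L - 1) K Mb (bondB K K₀ j Mb σ A) i *ᵥ pullB K K₀ j Mb u) z := by
  -- the box side
  rw [B4Lemma21Region.fld_covDeriv_mulVec_of_mem ((P.L - 1 + 1) ^ K) (fieldLink (flowC C) κ (bondB K K₀ j Mb σ A))
    (pullB K K₀ j Mb u) hz]
  have hW : fieldLink (flowC C) κ (bondB K K₀ j Mb σ A) z ⟨z.1 + e1 i, hz⟩
      = (flowC C).U (P.mesh 0 * C.e * A ⟨toT K K₀ j z.1, castD P i⟩) := by
    unfold fieldLink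
    rw [bondB_fwd j Mb C hκσ A (u := z) (v := ⟨z.1 + e1 i, hz⟩) rfl]
  rw [hW, fld_pullB_ofLp, fld_pullB_ofLp]
  -- the torus side
  have hL : covDeriv C A u ⟨toT K K₀ j z.1, castD P i⟩
      = (P.mesh 0)⁻¹ • (C.U (P.mesh 0) (A ⟨toT K K₀ j z.1, castD P i⟩) (u ((toT K K₀ j z.1).shift (castD P i)))
          - u (toT K K₀ j z.1)) := rfl
  rw [hL, WithLp.ofLp_smul, smul_smul, WithLp.ofLp_sub, ofLp_U, ← toT_add_e1, mesh_ratio]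

set_option maxHeartbeats 800000 in
/-- **THE PER-PIECE INPUTS OF THE TORUS RANDOM WALK AT A BOUNDARY PIECE «Ã_j = A» — LEMMA 2.2 (2.17) SUP MEMBERS AND (2.20) WITH NO
COLLAR ON A SUB-BOX OF THE (Higgs)₂,₃ TORUS** (p. 579 «we can apply Lemma 2.2 to all operators in it»).  QUANTIFIER ORDER: constants
`Cγ, Cβ > 0` first (from `B4Lemma22NoCollarContours` at the model's flow: they depend on `d, N, q, L, a₋, a₊, m²₊`); then for the regularity
pair `(creg, β)` and the window size `K₀ ≥ 8` a threshold `e₁`; then the instance: the torus (`K ≥ 1`, `K ≤ K_P`, `K₀ ∣ M_P`, `3M ≤ |T_ε|`),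
`a ∈ [a₋, a₊]`, `m² > 0` with `m²(L^Kε)² ≤ m²₊`, the chart label `j` and sides `Mb` (`1 ≤ Mb_i ≤ 2K₀`, `K₀ ∣ Mb_i`), a torus bump `h` reading
`hZ n K₀ jl` along the chart, ANY vector field `A` on `T_ε` whose scaled components `acT` (scale `σ = L^Kε·e/e_c`) are (1.7)-regular on the
sub-box, and the effective charge `0 < e_c ≤ e₁`.  CONCLUSION, for every `ψ` with `hψ` supported in `boxT`: `‖G(hψ)‖_∞ ≤ Cγ(L^Kε)²‖ψ‖_∞`,
`‖(D^ε_AG(hψ))(b)‖ ≤ Cγ(L^Kε)‖ψ‖_∞` on the bonds `b` of `boxT`, and `‖H(hG(hψ)) − hHG(hψ)‖_∞ ≤ (Cβ/K₀)‖ψ‖_∞`, `G = G^ε_K(boxT, A)`, `H` its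
inverse. [cite: Balaban1983RegularityDecay, Lemma 2.2 (2.17) p.578, (2.20) p.578, p.579 «we can apply Lemma 2.2 to all operators in it»]
[cite: Balaban1982Higgs1, Prop. 2.1 (2.23)–(2.25) pp.610–611, p.611 l.1–2] -/
theorem subbox_inputs (C : ChargeData N) (d0 ℓ0 : ℕ) (hℓ0 : 1 ≤ ℓ0) (amin aplus m2plus : ℝ) (ha : 0 < amin) :
    ∃ Cγ Cβ : ℝ, 0 < Cγ ∧ 0 < Cβ ∧ ∀ (creg β : ℝ), 0 ≤ creg → 0 < β → ∀ (K₀ : ℕ), 8 ≤ K₀ →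
      ∃ e₁ : ℝ, 0 < e₁ ∧ ∀ (P : HiggsLattice.Params), dd P = d0 → P.L - 1 = ℓ0 →
        ∀ (K : ℕ), 1 ≤ K → K ≤ P.K → K₀ ∣ P.M → (∀ μ, 3 * half P K K₀ ≤ P.sitesPerDir 0 μ) →
        ∀ (a msq : ℝ), amin ≤ a → a ≤ aplus → 0 < msq → msq * P.mesh K ^ 2 ≤ m2plus →
        ∀ (j : Lab P K K₀) (Mb : Fin (dd P + 1) → ℕ), (∀ i, 1 ≤ Mb i) → (∀ i, Mb i ≤ 2 * K₀) → (∀ i, K₀ ∣ Mb i) →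
        ∀ (h : HiggsLattice.Site P 0 → ℝ) (jl : Fin (dd P + 1) → ℤ),
          (∀ y ∈ Box (dd P) (P.L - 1) K Mb, h (toT K K₀ j y) = hZ ((P.L - 1 + 1) ^ K) K₀ jl y) →
        ∀ (A : HiggsLattice.VecField P 0) (ec : ℝ), 0 < ec → ec ≤ e₁ →
          (∀ y ∈ Box (dd P) (P.L - 1) K Mb, ∀ i i' : Fin (dd P + 1),
            |acT K K₀ j ((((P.L - 1 + 1) ^ K : ℕ) : ℝ) * P.mesh 0 * C.e / ec) A (y + e1 i) i'
              - acT K K₀ j ((((P.L - 1 + 1) ^ K : ℕ) : ℝ) * P.mesh 0 * C.e / ec) A y i'|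
              ≤ creg * ec ^ (β - 1) / ((P.L - 1 + 1) ^ K : ℕ)) →
          ∀ ψ : HiggsLattice.ScalarField P 0 N, (∀ x, x ∉ boxT K K₀ j Mb → (h • ψ) x = 0) →
            ‖propagatorK C (boxT K K₀ j Mb) A msq a K (h • ψ)‖ ≤ Cγ * P.mesh K ^ 2 * ‖ψ‖ ∧
            (∀ (x : HiggsLattice.Site P 0) (μ : Fin P.d), x ∈ boxT K K₀ j Mb → x.shift μ ∈ boxT K K₀ j Mb →
              ‖covDeriv C A (propagatorK C (boxT K K₀ j Mb) A msq a K (h • ψ)) ⟨x, μ⟩‖ ≤ Cγ * P.mesh K * ‖ψ‖) ∧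
            ‖covOpK C (boxT K K₀ j Mb) A msq a K (h • propagatorK C (boxT K K₀ j Mb) A msq a K (h • ψ))
                - h • covOpK C (boxT K K₀ j Mb) A msq a K (propagatorK C (boxT K K₀ j Mb) A msq a K (h • ψ))‖
              ≤ Cβ / K₀ * ‖ψ‖ := by
  classical
  obtain ⟨C₀, hC₀, hLγ⟩ := lemma22_sup_noCollar_contour (flowC C) (ellC_nonneg C) (flowC_lipschitz C) d0 ℓ0 hℓ0 amin aplus
    m2plus ha
  obtain ⟨Cb, hCb, hLβ⟩ := eq220_noCollar_contour (flowC C) (ellC_nonneg C) (flowC_lipschitz C) d0 ℓ0 hℓ0 amin aplus m2plus ha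
  refine ⟨C₀, Cb, hC₀, hCb, fun creg β hcreg hβ K₀ hK₀8 => ?_⟩
  have hK₀' : 1 ≤ K₀ := one_le_of_eight_le hK₀8
  obtain ⟨e₁, he₁, hthγ⟩ := hLγ creg β hcreg hβ (2 * K₀)
  obtain ⟨e₂, he₂, hthβ⟩ := hLβ creg β hcreg hβ (2 * K₀) K₀ hK₀'
  refine ⟨min e₁ e₂, lt_min he₁ he₂, ?_⟩
  intro P hd hl K hK1 hK hK₀ hN3 a msq e1' e2 hmsq e4 j Mb hMb1 hMb hKM h jl hh A ec hec hle h17 ψ hψ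
  subst hd; subst hl
  -- the instance
  have hℓ : 1 ≤ P.L - 1 := hℓ0
  have hL2 : 2 ≤ P.L := by omega
  have hn : 1 ≤ (P.L - 1 + 1) ^ K := one_le_n P K
  have hn2 : 2 ≤ (P.L - 1 + 1) ^ K := two_le_n hL2 hK1
  have hnK3 : 3 ≤ (P.L - 1 + 1) ^ K * K₀ := by nlinarith
  have hnr : (0 : ℝ) < (((P.L - 1 + 1) ^ K : ℕ) : ℝ) := by exact_mod_cast hn
  have hN3' : ∀ i, 3 ≤ (P.L - 1 + 1) ^ K * Mb i := fun i =>
    hnK3.trans (Nat.mul_le_mul_left _ (Nat.le_of_dvd (hMb1 i) (hKM i)))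
  have ha' : 0 < a := lt_of_lt_of_le ha e1'
  have hm2 : 0 ≤ msq * P.mesh K ^ 2 := by positivity
  have hmeshK : 0 < P.mesh K := by unfold HiggsLattice.Params.mesh; have := P.hε; have := P.hL; positivity
  have hakP : 0 ≤ B1.aSeq a P.L K := aSeq_nonneg_model hL2 ha' hK1
  have hle1 : ec ≤ e₁ := hle.trans (min_le_left _ _)
  have hle2 : ec ≤ e₂ := hle.trans (min_le_right _ _)
  -- the scaled field and the coupling `κ = e_c/n`, `κσ = εe`
  set σ : ℝ := (((P.L - 1 + 1) ^ K : ℕ) : ℝ) * P.mesh 0 * C.e / ec with hσ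
  have hκσ : ec / (((P.L - 1 + 1) ^ K : ℕ) : ℝ) * σ = P.mesh 0 * C.e := by
    rw [hσ]; field_simp
  have hb : bondB K K₀ j Mb σ A = fun u v => compField (acT K K₀ j σ A) u.1 v.1 := rfl
  -- the contour-system facts and the Lemma-2.2 conclusions on the sub-box
  have hlen : ∀ (y : ↥(boxDom Mb)) (x : ↥(Box (dd P) (P.L - 1) K Mb)),
      ((gammaB P K Mb y x).length : ℝ) ≤ ((dd P : ℝ) + 1) * ((((P.L - 1 + 1) ^ K : ℕ)) : ℝ) :=
    fun y x => length_gammaB_le_real y x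
  have hmemγ := hthγ K hK1 hn a _ e1' e2 hm2 e4 Mb hMb1 hMb hN3' (gammaB P K Mb) (fun y x => gammaB_nn y x)
    (fun y x hw => gammaB_hend y x hw) hlen (acT K K₀ j σ A) ec hec hle1 h17
  have hmemβ := hthβ K hK1 hn hnK3 a _ e1' e2 hm2 e4 Mb hMb1 hMb hKM (gammaB P K Mb) (fun y x => gammaB_nn y x)
    (fun y x hw => gammaB_hend y x hw) hlen jl (acT K K₀ j σ A) ec hec hle2 h17
  have hHS := B4Eq220PartitionSizes.hsize_hBox (d := dd P) hn hK₀' hnK3 hKM jl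
  -- the fields
  set Φ := mulH (hBox ((P.L - 1 + 1) ^ K) K₀ Mb jl) *ᵥ pullB K K₀ j Mb ψ with hΦ
  set u := propagatorK C (boxT K K₀ j Mb) A msq a K (h • ψ) with hu_def
  have hu : pullB K K₀ j Mb u = P.mesh K ^ 2 • (greenA (dd P) (flowC C) (ec / (((P.L - 1 + 1) ^ K : ℕ) : ℝ)) (P.L - 1) K a
      (msq * P.mesh K ^ 2) Mb (baseEmb (one_le_n P K) Mb) (gammaB P K Mb) (bondB K K₀ j Mb σ A) *ᵥ Φ) := by
    rw [hu_def, pullB_propagatorK C hK hK1 hK₀ hK₀8 hN3 hL2 j hMb hκσ ha' hmsq A, pullB_hsmul_of j hh ψ]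
  have hΦψ : supN Φ ≤ ‖ψ‖ := (B4Eq220CommutatorField.supN_mulH_le hHS.abs_le _).trans (supN_pullB_le j Mb ψ)
  have hψ0 : 0 ≤ ‖ψ‖ := norm_nonneg ψ
  -- supports
  have husupp : ∀ x, x ∉ boxT K K₀ j Mb → u x = 0 :=
    propagatorK_boxT_supported C hK hK₀ hK₀8 hN3 j hMb A hmsq hakP hψ
  refine ⟨?_, ?_, ?_⟩
  · -- (2.17), value member: `‖G(hψ)‖ ≤ C₀(L^Kε)²‖ψ‖`
    have hG := (hmemγ Φ).1
    rw [← hb] at hG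
    rw [norm_eq_supN_pullB j Mb husupp, hu]
    calc supN (P.mesh K ^ 2 • (greenA (dd P) (flowC C) (ec / (((P.L - 1 + 1) ^ K : ℕ) : ℝ)) (P.L - 1) K a
          (msq * P.mesh K ^ 2) Mb (baseEmb (one_le_n P K) Mb) (gammaB P K Mb) (bondB K K₀ j Mb σ A) *ᵥ Φ))
        ≤ |P.mesh K ^ 2| * supN (greenA (dd P) (flowC C) (ec / (((P.L - 1 + 1) ^ K : ℕ) : ℝ)) (P.L - 1) K a
          (msq * P.mesh K ^ 2) Mb (baseEmb (one_le_n P K) Mb) (gammaB P K Mb) (bondB K K₀ j Mb σ A) *ᵥ Φ) :=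
          supN_smul_le _ _
      _ ≤ |P.mesh K ^ 2| * (C₀ * ‖ψ‖) :=
          mul_le_mul_of_nonneg_left (hG.trans (mul_le_mul_of_nonneg_left hΦψ hC₀.le)) (abs_nonneg _)
      _ = C₀ * P.mesh K ^ 2 * ‖ψ‖ := by rw [abs_of_nonneg (by positivity)]; ring
  · -- (2.17), derivative member, read on the torus bond `⟨x, x + εe_μ⟩ ⊂ boxT`
    intro x μ hxc hsc
    set z : Fin (dd P + 1) → ℤ := fromT K K₀ j x with hz_def
    have hz : z ∈ Box (dd P) (P.L - 1) K Mb := mem_boxT_iff.1 hxc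
    have hxz : toT K K₀ j z = x := toT_fromT j x
    set i : Fin (dd P + 1) := (castD P).symm μ with hi_def
    have hμ : castD P i = μ := Equiv.apply_symm_apply _ _
    have hz' : z + e1 i ∈ Box (dd P) (P.L - 1) K Mb :=
      (add_e1_mem_boxB_iff hK hK₀ hK₀8 hN3 j hMb hz i).2 (by rw [hxz, hμ]; exact hsc)
    have key := smul_ofLp_covDeriv_toT_sub C j hκσ A u ⟨z, hz⟩ i hz'
    simp only at key
    rw [hxz, hμ, hu, Matrix.mulVec_smul] at key
    have main := (hmemγ Φ).2 i
    rw [← hb] at main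
    have hsite := le_supN (P.mesh K ^ 2 • (derivA (dd P) (flowC C) (ec / (((P.L - 1 + 1) ^ K : ℕ) : ℝ)) (P.L - 1) K Mb
      (bondB K K₀ j Mb σ A) i *ᵥ (greenA (dd P) (flowC C) (ec / (((P.L - 1 + 1) ^ K : ℕ) : ℝ)) (P.L - 1) K a
        (msq * P.mesh K ^ 2) Mb (baseEmb (one_le_n P K) Mb) (gammaB P K Mb) (bondB K K₀ j Mb σ A) *ᵥ Φ))) ⟨z, hz⟩
    rw [← key] at hsite
    have hsn : siteNorm (P.mesh K • WithLp.ofLp (covDeriv C A u ⟨x, μ⟩)) = P.mesh K * ‖covDeriv C A u ⟨x, μ⟩‖ := by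
      rw [siteNorm_smul, abs_of_pos hmeshK, siteNorm_ofLp']
    rw [hsn] at hsite
    have hsup := (supN_smul_le (P.mesh K ^ 2) (derivA (dd P) (flowC C) (ec / (((P.L - 1 + 1) ^ K : ℕ) : ℝ)) (P.L - 1) K Mb
      (bondB K K₀ j Mb σ A) i *ᵥ (greenA (dd P) (flowC C) (ec / (((P.L - 1 + 1) ^ K : ℕ) : ℝ)) (P.L - 1) K a
        (msq * P.mesh K ^ 2) Mb (baseEmb (one_le_n P K) Mb) (gammaB P K Mb) (bondB K K₀ j Mb σ A) *ᵥ Φ))).trans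
      (mul_le_mul_of_nonneg_left (main.trans (mul_le_mul_of_nonneg_left hΦψ hC₀.le)) (abs_nonneg _))
    rw [abs_of_pos (by positivity)] at hsup
    have hfin : P.mesh K * ‖covDeriv C A u ⟨x, μ⟩‖ ≤ P.mesh K * (C₀ * P.mesh K * ‖ψ‖) := by
      refine (hsite.trans hsup).trans (le_of_eq ?_)
      ring
    exact le_of_mul_le_mul_left hfin hmeshK
  · -- (2.20): `‖H(hG(hψ)) − hHG(hψ)‖ ≤ (Cb/K₀)‖ψ‖`
    have main := hmemβ (pullB K K₀ j Mb ψ)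
    rw [← hb] at main
    have hv := pullB_commutator_of C hK hK₀ hK₀8 hN3 j hMb hκσ a msq A hh u
    -- support of the commutator field
    have hhu : ∀ x, x ∉ boxT K K₀ j Mb → (h • u) x = 0 := fun x hx => by
      rw [Pi.smul_apply', husupp x hx, smul_zero]
    have hvsupp : ∀ x, x ∉ boxT K K₀ j Mb →
        (covOpK C (boxT K K₀ j Mb) A msq a K (h • u) - h • covOpK C (boxT K K₀ j Mb) A msq a K u) x = 0 := by
      intro x hx
      rw [Pi.sub_apply, covOpK_boxT_supported C hK hK₀ hK₀8 hN3 j hMb A msq a hhu x hx, Pi.smul_apply',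
        covOpK_boxT_supported C hK hK₀ hK₀8 hN3 j hMb A msq a husupp x hx, smul_zero, sub_zero]
    have hs0 : P.mesh K ^ 2 ≠ 0 := by positivity
    rw [norm_eq_supN_pullB j Mb hvsupp, hv, hu, Matrix.mulVec_smul, smul_smul, inv_mul_cancel₀ hs0, one_smul, supN_neg]
    refine main.trans ?_
    exact mul_le_mul_of_nonneg_left (supN_pullB_le j Mb ψ) (by positivity)

end Inputs

end Literature.MathematicalPhysics.QuantumFieldTheory.Balaban1983to89.B1TorusSubBoxOp
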